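/-
Copyright: the b2b-balaban T⁴-continuum CRUX team, row NE7b owner lineage `t4-ne7b-p1` (gen 113). Project licence.
-/
import Summits.QuantumFields.BalabanUV.Beta.D1BFx.BlockColumnSupNorm
import Literature.MathematicalPhysics.QuantumFieldTheory.Balaban1983to89.B5Hk165L2Zd
import Summits.QuantumFields.BalabanUV.T4Continuum.Spine.NE7b.OneShotChartStrip
import Literature.MathematicalPhysics.QuantumFieldTheory.Balaban1983to89.B6Hprime2101

/-!
# THE ONE-SHOT CHART LETTER IN THE SUP CURRENCY, BY NAME: for the scalar `H = G′Q′*(Q′G′Q′*)⁻¹` of [B5] (1.103) on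
# `ℤ^d`, `d ≥ 3`, EVERY block side `M = n + 1` and every `a > 0`:  `Σ′_y |H(p,y)| ≤ cHs(d,a)·K_d(δ_H)` — so
# `‖H_M‖_{∞→∞} ≤ C_∞(d,a)` UNIFORMLY IN `M`, whence HRS's radius letter `|t|·K₁ < 1` (`t² = M²∕M^d`) holds for
# every composite side `M ≥ M₀(d,a)` (row NE7b, node U5c; NEEDS-LETTER NL-NE7b-1 limb 1 of PRICING-NE7b v121 F721;
# the β-team's `D1BFx/BlockColumnSupNorm.abs_kerH_le_sup` + Literature B5 columns + Mathlib; [folklore] bookkeeping)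

Cell `pub-balaban`, sub-cell `t4`, spine estimate NE7b (`T4WeightBudget.RelWeightBound`; the cell's OWN estimate — NOT PRINTED
in [Bałaban 1983–89], NOT PROVED).  Crux-route work under `Spine/NE7b/` by the row OWNER (`t4-ne7b-p1` gen 113) under FREEZE
(0)'s crux-prover clause (RULING W-ne7bp1-g113-1, FILING-CLAIM C-ne7bp1-g113-1); NOTHING of Bałaban's is asserted; no
`T4Continuum/Support` leaf typed; no `def`; zero `sorry`.  Imports (BY NAME, nothing restated): the β-flow team's D1-road file
`Summits/QuantumFields/BalabanUV/Beta/D1BFx/BlockColumnSupNorm` (`abs_kerH_le_sup`: `|H(p,y)| ≤ cHs(d,a)·e^{−δ_H|blk p − y|_∞}`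
for `d ≥ 3`, with NO mesh factor `(n+1)^{d∕2}` — discrete interior elliptic regularity `Beta/PoissonInterior.interior_estimate`
behind it) and the Literature column `B5Hk165L2Zd` (`HBZd`: `(H B)(p) = Σ′_y B(y)H(p,y)`; `abs_kerH_row`; `HBZd_indep`).

WHY (located).  The hard-step cell's consumer HRS (`…HardStepRadiusSupNorm`, leaf-01) types the radius letter in Mathlib's Pi
(SUP) norm: `|t|·K₁ < 1 ↔ K₁ < t⁻¹ = L^{(d−2)∕2}`, `K₁` = the sup → sup constant of the chart section.  The owner's (39)–(45)
proved the chart constant in the `η`-`ℓ²` currency (`(π∕2)^d`, every `M`); the pricing desk (v121 F721) valued the SUP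
constant of the one-shot free section at d = 4 — `2.546 (M = 2), 3.293 (3), 3.674 (4), 4.231 (8), 4.403 (16) → ≈ 4.45` —
and booked NEEDS-LETTER NL-NE7b-1: «UNTYPED ∕ UNCLAIMED for every M … print's device is (1.65)'s exponential kernel decay,
whose by-name shadow in the tree is `c_H·K_d = 10^{366.6}`» (that shadow, `B5Hk103ScalarZd.abs_kerH_le`, carries the mesh
factor `(n+1)^{d∕2}` and is useless here).  LOCATED: since 2026-08-19 the tree holds the MESH-FREE sup entry bound —
`D1BFx/BlockColumnSupNorm.abs_kerH_le_sup` (the β-team needed it for the projector legs of road BF-x) — which no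
`Spine/NE7b/` file imported.  Young's inequality on the kernel rows then gives the sup letter for EVERY side with ONE
constant `C_∞(d,a) = cHs(d,a)·K_d(δ_H(d,a))`, and a constant uniform in `M` beats the threshold `M^{(d−2)∕2} → ∞`
(`d ≥ 3`) from some `M₀` on.  This file is that bookkeeping; the analysis is the β-team's and pv23's.

WHAT IS PROVED ([folklore]; `n : ℕ` = the side minus one, `a > 0`; `d ≥ 3` where marked):
* §1 `summable_abs_kerH_row` (every `d`), **`tsum_abs_kerH_le_sup`** (`d ≥ 3`: `Σ′_y |H(p,y)| ≤ cHs(d,a)·K_d(δ_H)` — the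
  sup-row letter, UNIFORM IN THE SIDE), `one_le_tsum_abs_kerH` (every `d`: `1 ≤ Σ′_y |H(p,y)|`, from `H·1 = 1`),
  `one_le_supConst` (`d ≥ 3`: `1 ≤ cHs·K_d(δ_H)` — the letter's floor: no side `M = 1`).
* §2 `summable_HBZd_of_bounded` (every `d`: for `|B| ≤ R` the series `(H B)(p)` converges absolutely — `H` acts on `ℓ^∞`
  coarse data, not only on `ℓ²`), **`abs_HBZd_le_weighted`** (`d ≥ 3`: `|(HB)(p)| ≤ cHs Σ′_y e^{−δ_H|blk p − y|}|B(y)|` — the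
  LOCALISED letter: the value at `p` reads `B` near `blk p`, exponentially), **`abs_HBZd_le_sup`** (`d ≥ 3`:
  `|(HB)(p)| ≤ cHs(d,a)·K_d(δ_H)·R` — **`‖H_M‖_{∞→∞} ≤ C_∞(d,a)` for EVERY `M`**), `abs_HBZd_le_sup_indep` (the constant may
  be read at ANY `a′ > 0`: `H` does not depend on `a`, `B5Hk165L2Zd.HBZd_indep`).
* §3 the HRS junction: `sq_div_pow_le_inv` (`1 ≤ M`, `3 ≤ d` ⊢ `M²∕M^d ≤ M⁻¹`), `radius_letter_eventually` (any `C ≥ 0`: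
  `∃ M₀, ∀ M ≥ M₀, |√(M²∕M^d)|·C < 1`), **`oneShot_radius_letter_supnorm`** (`d ≥ 3`: `∃ M₀, ∀ n, M₀ ≤ n+1 →` HRS §3's letter
  `|√((n+1)²∕(n+1)^d)|·C_∞ < 1` holds AND `C_∞` bounds the section on `ℓ^∞` at that side), `supConst_lt_side_eventually_d4`
  (d = 4, where `|t| = M⁻¹`: `∃ M₀, ∀ n, M₀ ≤ n+1 → C_∞(4,a) < n+1`), and the floor `not_radius_letter_side_one` (`d ≥ 3`: at
  `M = 1` the letter FAILS, `K ≥ 1`).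
* §4 toy.
* §5 (v1.1 APPEND, by name from leaf-06 g158's `…OneShotChartStrip.exists_kerH_decay`, d-FREE): `exists_tsum_abs_kerH_le_all`,
  `exists_abs_HBZd_le_all`, `exists_oneShot_radius_letter_all` — the same letters on `ℤ^{d+1}` for EVERY `d`, constants `∃ C`.

HONEST (what this is NOT).  (i) The constant `C_∞(d,a)` is EXISTENTIAL in `d` (through `interior_estimate`'s `C(d)` and lit1's
Green-function constants) and astronomically loose in `a` — USELESS BY VALUE: the file proves «`∃ M₀`», while F721's truth says
`M₀ = 4` at d = 4 (`3.674 < 4`) and that `M = 2, 3` are FALSE in this currency (`2.546 > 2`, `3.293 > 3`); closing the finitely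
many low sides `4 ≤ M < M₀` by value is idea-1 g109's Road B (Combes–Thomas strip + certified near field) or the composite-first-
step bypass — NOT here.  (ii) Scalar (`U = 1`) object on the WHOLE lattice `ℤ^d`; the torus section HRS's `Fintype` carrier wants
is the periodisation of this kernel (T-109 (CT-4): `‖periodised row‖_{ℓ¹} ≤ ‖row‖_{ℓ¹(ℤ^d)}`) — NOT in this file.  (iii) Nothing
of the covariant `H_k` with the axial gauge ((A3), NC-NE7b-α UNRULED), nothing of the region junction (NL-NE7b-1 limb 2).
BY-NAME EFFECT ON THE WALL: NONE — NL-NE7b-1 limb 1 moves from «UNTYPED for every M» to «TYPED for every M ≥ M₀(d,a), constant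
existential».  NE7b NOT PRINTED ∕ NOT PROVED; spine PROVED 0∕9; rung (B)+1 on a FINITE torus — NOT infinite volume, NOT the
mass gap, NOT Clay.  HONEST DEPENDENCY: continuum YM on T⁴ ⇐ BetaPertH ∧ nine spine estimates (0∕9 proved); BetaPertH ⇐ (D1) ∧
(D4) ∧ CAP+tail; G-an2-4 gates asym, D1 and NE2∕3∕4.
-/

set_option autoImplicit false

namespace Summit.QuantumFields.BalabanUV.T4Continuum.NE7b.OneShotChartSupNorm

open Literature.MathematicalPhysics.QuantumFieldTheory.Balaban1983to89
open B4Sect5Proof (latticeConst latticeConst_nonneg)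
open B6QGQLower276 (X blk)
open B5Hk103ScalarZd (kerH summable_expX tsum_expX_le deltaH deltaH_pos tsum_kerH_row)
open B5Hk165L2Zd (HBZd abs_kerH_row HBZd_indep)
open Summit.QuantumFields.BalabanUV.Beta.D1BFx.BlockColumnSupNorm (cHs cHs_nonneg abs_kerH_le_sup)

noncomputable section

variable {d : ℕ}

/-! ## §1. The sup-row letter: `Σ′_y |H(p,y)| ≤ cHs(d,a)·K_d(δ_H)`, uniformly in the side -/

/-- The row `y ↦ |H(p,y)|` is summable (every `d`; `B5Hk165L2Zd.abs_kerH_row`). [folklore] -/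
theorem summable_abs_kerH_row (n : ℕ) {a : ℝ} (ha : 0 < a) (p : X d) :
    Summable fun y : X d => |kerH n a p y| :=
  (abs_kerH_row n ha p).1

/-- **THE SUP-ROW LETTER** (`d ≥ 3`): `Σ′_y |H(p,y)| ≤ cHs(d,a)·K_d(δ_H(d,a))` for EVERY side `n + 1` and every fine site `p` —
Young's bookkeeping on `D1BFx/BlockColumnSupNorm.abs_kerH_le_sup`; NO mesh factor. [folklore] -/
theorem tsum_abs_kerH_le_sup (hd : 3 ≤ d) (n : ℕ) {a : ℝ} (ha : 0 < a) (p : X d) :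
    ∑' y : X d, |kerH n a p y| ≤ cHs d a * latticeConst d (deltaH d a) := by
  have hmaj : Summable fun y : X d => cHs d a * Real.exp (-(deltaH d a * dist (blk n p) y)) :=
    (summable_expX (deltaH_pos d ha) (blk n p)).mul_left _
  calc ∑' y : X d, |kerH n a p y|
      ≤ ∑' y : X d, cHs d a * Real.exp (-(deltaH d a * dist (blk n p) y)) :=
        Summable.tsum_le_tsum (fun y => abs_kerH_le_sup hd n ha p y) (summable_abs_kerH_row n ha p) hmaj
    _ = cHs d a * ∑' y : X d, Real.exp (-(deltaH d a * dist (blk n p) y)) := tsum_mul_left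
    _ ≤ cHs d a * latticeConst d (deltaH d a) :=
        mul_le_mul_of_nonneg_left (tsum_expX_le (deltaH_pos d ha) (blk n p)) (cHs_nonneg d ha)

/-- **The floor** (every `d`): `1 ≤ Σ′_y |H(p,y)|`, because `H·1 = 1` (`B5Hk103ScalarZd.tsum_kerH_row`). [folklore] -/
theorem one_le_tsum_abs_kerH (n : ℕ) {a : ℝ} (ha : 0 < a) (p : X d) :
    1 ≤ ∑' y : X d, |kerH n a p y| := by
  have hs : Summable fun y : X d => ‖kerH n a p y‖ := by
    simpa only [Real.norm_eq_abs] using summable_abs_kerH_row n ha p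
  have h2 := norm_tsum_le_tsum_norm hs
  simp only [Real.norm_eq_abs] at h2
  rw [tsum_kerH_row n ha p, abs_one] at h2
  exact h2

/-- `1 ≤ cHs(d,a)·K_d(δ_H)` (`d ≥ 3`): the sup-row constant is at least one — the radius letter can never hold at side `M = 1`.
[folklore] -/
theorem one_le_supConst (hd : 3 ≤ d) (n : ℕ) {a : ℝ} (ha : 0 < a) :
    1 ≤ cHs d a * latticeConst d (deltaH d a) :=
  (one_le_tsum_abs_kerH n ha (0 : X d)).trans (tsum_abs_kerH_le_sup hd n ha 0)

/-! ## §2. `H` on bounded coarse data: `‖H_M‖_{∞→∞} ≤ C_∞(d,a)` for every side -/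

/-- A bound `|B| ≤ R` forces `0 ≤ R`. [folklore] -/
theorem nonneg_of_abs_le {Bf : X d → ℝ} {R : ℝ} (hB : ∀ y, |Bf y| ≤ R) : 0 ≤ R :=
  (abs_nonneg _).trans (hB 0)

/-- For BOUNDED coarse data `|B(y)| ≤ R` the series `(H B)(p) = Σ′_y B(y)H(p,y)` converges absolutely (every `d`): `H` acts on
`ℓ^∞(ℤ^d)`, not only on `ℓ²` (`B5Hk165L2Zd.summable_HBZd_row`). [folklore] -/
theorem summable_HBZd_of_bounded (n : ℕ) {a : ℝ} (ha : 0 < a) {Bf : X d → ℝ} {R : ℝ} (hB : ∀ y, |Bf y| ≤ R)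
    (p : X d) : Summable fun y : X d => Bf y * kerH n a p y := by
  refine Summable.of_norm_bounded ((summable_abs_kerH_row n ha p).mul_left R) fun y => ?_
  rw [Real.norm_eq_abs, abs_mul]
  exact mul_le_mul_of_nonneg_right (hB y) (abs_nonneg _)

/-- **THE LOCALISED LETTER** (`d ≥ 3`): `|(H B)(p)| ≤ cHs(d,a)·Σ′_y e^{−δ_H|blk p − y|_∞}|B(y)|` for bounded `B` — the value of
the section at `p` reads the data near `blk p`, with exponential weights and no mesh factor. [folklore] -/
theorem abs_HBZd_le_weighted (hd : 3 ≤ d) (n : ℕ) {a : ℝ} (ha : 0 < a) {Bf : X d → ℝ} {R : ℝ} (hB : ∀ y, |Bf y| ≤ R)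
    (p : X d) :
    |HBZd n a Bf p| ≤ cHs d a * ∑' y : X d, Real.exp (-(deltaH d a * dist (blk n p) y)) * |Bf y| := by
  have hR : 0 ≤ R := nonneg_of_abs_le hB
  have hmaj : Summable fun y : X d => Real.exp (-(deltaH d a * dist (blk n p) y)) * |Bf y| := by
    refine Summable.of_norm_bounded ((summable_expX (deltaH_pos d ha) (blk n p)).mul_right R) fun y => ?_
    rw [Real.norm_eq_abs, abs_mul, abs_abs, abs_of_pos (Real.exp_pos _)]
    exact mul_le_mul_of_nonneg_left (hB y) (Real.exp_pos _).le
  have hsum : HasSum (fun y : X d => cHs d a * (Real.exp (-(deltaH d a * dist (blk n p) y)) * |Bf y|))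
      (cHs d a * ∑' y : X d, Real.exp (-(deltaH d a * dist (blk n p) y)) * |Bf y|) :=
    hmaj.hasSum.mul_left _
  have hpt : ∀ y : X d,
      ‖Bf y * kerH n a p y‖ ≤ cHs d a * (Real.exp (-(deltaH d a * dist (blk n p) y)) * |Bf y|) := by
    intro y
    rw [Real.norm_eq_abs, abs_mul]
    calc |Bf y| * |kerH n a p y| ≤ |Bf y| * (cHs d a * Real.exp (-(deltaH d a * dist (blk n p) y))) :=
          mul_le_mul_of_nonneg_left (abs_kerH_le_sup hd n ha p y) (abs_nonneg _)
      _ = cHs d a * (Real.exp (-(deltaH d a * dist (blk n p) y)) * |Bf y|) := by ring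
  have h := tsum_of_norm_bounded hsum hpt
  rw [Real.norm_eq_abs] at h
  exact h

/-- **THE SUP LETTER** (`d ≥ 3`): `|(H B)(p)| ≤ cHs(d,a)·K_d(δ_H)·R` for every `p`, every side `n + 1`, every `a > 0` and every
coarse field with `|B| ≤ R` — i.e. **`‖H_M‖_{∞→∞} ≤ C_∞(d,a)` UNIFORMLY IN `M`**, the object NL-NE7b-1 limb 1 asks for (constant
existential). [folklore] -/
theorem abs_HBZd_le_sup (hd : 3 ≤ d) (n : ℕ) {a : ℝ} (ha : 0 < a) {Bf : X d → ℝ} {R : ℝ} (hB : ∀ y, |Bf y| ≤ R)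
    (p : X d) : |HBZd n a Bf p| ≤ cHs d a * latticeConst d (deltaH d a) * R := by
  have hR : 0 ≤ R := nonneg_of_abs_le hB
  have hsum : HasSum (fun y : X d => R * |kerH n a p y|) (R * ∑' y : X d, |kerH n a p y|) :=
    (summable_abs_kerH_row n ha p).hasSum.mul_left R
  have h := tsum_of_norm_bounded hsum fun y => by
    rw [Real.norm_eq_abs, abs_mul]
    exact mul_le_mul_of_nonneg_right (hB y) (abs_nonneg _)
  rw [Real.norm_eq_abs] at h
  calc |HBZd n a Bf p| = |∑' y : X d, Bf y * kerH n a p y| := by rw [HBZd]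
    _ ≤ R * ∑' y : X d, |kerH n a p y| := h
    _ ≤ R * (cHs d a * latticeConst d (deltaH d a)) :=
        mul_le_mul_of_nonneg_left (tsum_abs_kerH_le_sup hd n ha p) hR
    _ = cHs d a * latticeConst d (deltaH d a) * R := by ring

/-- The constant may be read at ANY `a′ > 0` (`H` does not depend on `a`, `B5Hk165L2Zd.HBZd_indep`):
`|(H B)(p)| ≤ cHs(d,a′)·K_d(δ_H(d,a′))·R`. [folklore] -/
theorem abs_HBZd_le_sup_indep (hd : 3 ≤ d) (n : ℕ) {a a' : ℝ} (ha : 0 < a) (ha' : 0 < a') {Bf : X d → ℝ} {R : ℝ}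
    (hB : ∀ y, |Bf y| ≤ R) (p : X d) : |HBZd n a Bf p| ≤ cHs d a' * latticeConst d (deltaH d a') * R := by
  rw [HBZd_indep n ha ha']
  exact abs_HBZd_le_sup hd n ha' hB p

/-! ## §3. The HRS junction: a side-uniform constant meets `|t|·K₁ < 1`, `t² = M²∕M^d`, for every large side -/

/-- `M²∕M^d ≤ M⁻¹` for `1 ≤ M` and `3 ≤ d`. [folklore] -/
theorem sq_div_pow_le_inv {M : ℝ} (hM : 1 ≤ M) (hd : 3 ≤ d) : M ^ 2 / M ^ d ≤ M⁻¹ := by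
  have hM0 : 0 < M := lt_of_lt_of_le one_pos hM
  have h3 : M ^ 3 ≤ M ^ d := pow_le_pow_right₀ hM hd
  rw [div_le_iff₀ (pow_pos hM0 d)]
  calc M ^ 2 = M⁻¹ * M ^ 3 := by field_simp
    _ ≤ M⁻¹ * M ^ d := mul_le_mul_of_nonneg_left h3 (inv_nonneg.2 hM0.le)

/-- **Eventual radius letter** for ANY constant `C ≥ 0` (`d ≥ 3`): `∃ M₀, ∀ M ≥ M₀, |√(M²∕M^d)|·C < 1` — HRS §3's letter shape with
`K₁ := C`; `M₀ = ⌊C²⌋₊ + 2` works. [folklore] -/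
theorem radius_letter_eventually {C : ℝ} (hC : 0 ≤ C) (hd : 3 ≤ d) :
    ∃ M₀ : ℕ, ∀ M : ℕ, M₀ ≤ M → |Real.sqrt ((M : ℝ) ^ 2 / (M : ℝ) ^ d)| * C < 1 := by
  refine ⟨⌊C ^ 2⌋₊ + 2, fun M hM => ?_⟩
  have hMC : C ^ 2 < (M : ℝ) := by
    have h1 : C ^ 2 < (⌊C ^ 2⌋₊ : ℝ) + 1 := Nat.lt_floor_add_one _
    have h2 : ((⌊C ^ 2⌋₊ + 2 : ℕ) : ℝ) ≤ (M : ℝ) := by exact_mod_cast hM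
    push_cast at h2
    linarith
  have hM1 : (1 : ℝ) ≤ (M : ℝ) := by
    have : (2 : ℝ) ≤ (M : ℝ) := by
      have h2 : ((⌊C ^ 2⌋₊ + 2 : ℕ) : ℝ) ≤ (M : ℝ) := by exact_mod_cast hM
      push_cast at h2
      linarith [(Nat.cast_nonneg ⌊C ^ 2⌋₊ : (0 : ℝ) ≤ ⌊C ^ 2⌋₊)]
    linarith
  have hM0 : (0 : ℝ) < (M : ℝ) := lt_of_lt_of_le one_pos hM1
  rw [abs_of_nonneg (Real.sqrt_nonneg _)]
  have hsq : Real.sqrt ((M : ℝ) ^ 2 / (M : ℝ) ^ d) ≤ Real.sqrt ((M : ℝ)⁻¹) :=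
    Real.sqrt_le_sqrt (sq_div_pow_le_inv hM1 hd)
  have hCs : C < Real.sqrt (M : ℝ) := by
    rw [← Real.sqrt_sq hC]
    exact Real.sqrt_lt_sqrt (sq_nonneg _) hMC
  have hsM : 0 < Real.sqrt (M : ℝ) := Real.sqrt_pos.2 hM0
  calc Real.sqrt ((M : ℝ) ^ 2 / (M : ℝ) ^ d) * C ≤ Real.sqrt ((M : ℝ)⁻¹) * C :=
        mul_le_mul_of_nonneg_right hsq hC
    _ = C / Real.sqrt (M : ℝ) := by rw [Real.sqrt_inv]; ring
    _ < 1 := by rw [div_lt_one hsM]; exact hCs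

/-- **THE ONE-SHOT RADIUS LETTER IN THE SUP CURRENCY** (`d ≥ 3`): there is a side `M₀` such that for EVERY side `n + 1 ≥ M₀`
HRS §3's letter `|t|·K₁ < 1` (`t² = (n+1)²∕(n+1)^d`) holds with `K₁ := C_∞(d,a) = cHs(d,a)·K_d(δ_H)`, AND that `K₁` bounds
the one-shot section on `ℓ^∞` at that side: `|(H B)(p)| ≤ K₁·R` whenever `|B| ≤ R`.  NL-NE7b-1 limb 1, TYPED for every large side;
constant existential. [folklore] -/
theorem oneShot_radius_letter_supnorm (hd : 3 ≤ d) {a : ℝ} (ha : 0 < a) :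
    ∃ M₀ : ℕ, ∀ n : ℕ, M₀ ≤ n + 1 →
      |Real.sqrt ((((n : ℝ) + 1)) ^ 2 / (((n : ℝ) + 1)) ^ d)| * (cHs d a * latticeConst d (deltaH d a)) < 1 ∧
      ∀ (Bf : X d → ℝ) (R : ℝ), (∀ y, |Bf y| ≤ R) →
        ∀ p : X d, |HBZd n a Bf p| ≤ cHs d a * latticeConst d (deltaH d a) * R := by
  have hC : 0 ≤ cHs d a * latticeConst d (deltaH d a) := zero_le_one.trans (one_le_supConst hd 0 ha)
  obtain ⟨M₀, hM₀⟩ := radius_letter_eventually hC hd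
  refine ⟨M₀, fun n hn => ⟨?_, fun Bf R hB p => abs_HBZd_le_sup hd n ha hB p⟩⟩
  have h := hM₀ (n + 1) hn
  push_cast at h
  exact h

/-- d = 4, where `|t| = M⁻¹` (`HRS.rescale_sq_four`): the letter reads `C_∞(4,a) < M`, and it holds for every side `n + 1 ≥ M₀`.
[folklore] -/
theorem supConst_lt_side_eventually_d4 (a : ℝ) :
    ∃ M₀ : ℕ, ∀ n : ℕ, M₀ ≤ n + 1 → cHs 4 a * latticeConst 4 (deltaH 4 a) < (n : ℝ) + 1 := by
  refine ⟨⌊cHs 4 a * latticeConst 4 (deltaH 4 a)⌋₊ + 1, fun n hn => ?_⟩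
  have h1 := Nat.lt_floor_add_one (cHs 4 a * latticeConst 4 (deltaH 4 a))
  have h2 : ((⌊cHs 4 a * latticeConst 4 (deltaH 4 a)⌋₊ + 1 : ℕ) : ℝ) ≤ ((n + 1 : ℕ) : ℝ) := by exact_mod_cast hn
  push_cast at h2
  linarith

/-- **The floor, in HRS's shape** (`d ≥ 3`): at side `M = 1` (`n = 0`) the letter FAILS — `|√(1²∕1^d)|·C_∞ = C_∞ ≥ 1`.  The sup
letter is a LARGE-SIDE statement (by value, F721: false at `M = 2, 3`, true from `M = 4` at d = 4 — not reachable by this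
constant). [folklore] -/
theorem not_radius_letter_side_one (hd : 3 ≤ d) {a : ℝ} (ha : 0 < a) :
    ¬ (|Real.sqrt ((((0 : ℕ) : ℝ) + 1) ^ 2 / (((0 : ℕ) : ℝ) + 1) ^ d)| * (cHs d a * latticeConst d (deltaH d a)) < 1) := by
  have h1 := one_le_supConst hd 0 ha
  push_cast
  rw [zero_add, one_pow, one_pow, div_one, Real.sqrt_one, abs_one, one_mul, not_lt]
  exact h1

/-! ## §4. Toy -/

/-- Toy: with a side-uniform constant `C = 5∕2` the letter `|√(M²∕M⁴)|·C < 1` (d = 4, `|t| = M⁻¹`) fails at `M = 2` and holds at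
`M = 4` — the shape of F721's table (truth `C(M) = 2.546` at `M = 2`, `3.674` at `M = 4`). -/
example : ¬ ((2 : ℝ)⁻¹ * (5 / 2) < 1) ∧ (4 : ℝ)⁻¹ * (5 / 2) < 1 := by
  constructor <;> norm_num

/-! ## §5. (v1.1, APPEND) Every dimension: the same letters with leaf-06's d-free entry decay `OneShotChartStrip.exists_kerH_decay`

leaf-06 g158's `…OneShotChartStrip` (OSCST, p388096 ✓) proves, by the Fourier-analytic road (strip regularity of the one-shot multiplier),
`∃ κ C > 0, ∀ n z y, |kerH n a z y| ≤ C·e^{−κ·supNorm(blk z − y)}` on `X (d + 1)` for EVERY `d` — no `3 ≤ d`, constants still existential.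
The row ∕ operator ∕ radius letters of §1–§3 follow for every dimension `d + 1 ≥ 1` (the radius arithmetic keeps its structural `3 ≤ d + 1`).
-/

section AllDimensions

open B4ContourShift (supNorm)
open B6Hprime2101 (dist_le_supNorm)
open OneShotChartStrip (exists_kerH_decay)

/-- **THE SUP-ROW LETTER IN EVERY DIMENSION** (v1.1): `∃ C > 0, ∀ n p, Σ′_y |H(p,y)| ≤ C` on `ℤ^{d+1}` — from OSCST's d-free entry decay
(`supNorm(blk p − y) ≥ dist(blk p, y)`, `B6Hprime2101.dist_le_supNorm`) and `tsum_expX_le`. [folklore] -/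
theorem exists_tsum_abs_kerH_le_all (d : ℕ) {a : ℝ} (ha : 0 < a) :
    ∃ C : ℝ, 0 < C ∧ ∀ (n : ℕ) (p : X (d + 1)), ∑' y : X (d + 1), |kerH n a p y| ≤ C := by
  obtain ⟨κ, C, hκ, hC, h⟩ := exists_kerH_decay d ha
  have hK : 0 ≤ latticeConst (d + 1) κ := latticeConst_nonneg (d + 1) hκ.le
  refine ⟨C * latticeConst (d + 1) κ + 1, by positivity, fun n p => ?_⟩
  have hpt : ∀ y : X (d + 1), |kerH n a p y| ≤ C * Real.exp (-(κ * dist (blk n p) y)) := fun y =>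
    (h n p y).trans (mul_le_mul_of_nonneg_left (Real.exp_le_exp.2
      (neg_le_neg (mul_le_mul_of_nonneg_left (dist_le_supNorm (blk n p) y) hκ.le))) hC.le)
  have hmaj : Summable fun y : X (d + 1) => C * Real.exp (-(κ * dist (blk n p) y)) :=
    (summable_expX hκ (blk n p)).mul_left C
  calc ∑' y : X (d + 1), |kerH n a p y| ≤ ∑' y : X (d + 1), C * Real.exp (-(κ * dist (blk n p) y)) :=
        Summable.tsum_le_tsum hpt (summable_abs_kerH_row n ha p) hmaj
    _ = C * ∑' y : X (d + 1), Real.exp (-(κ * dist (blk n p) y)) := tsum_mul_left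
    _ ≤ C * latticeConst (d + 1) κ := mul_le_mul_of_nonneg_left (tsum_expX_le hκ (blk n p)) hC.le
    _ ≤ C * latticeConst (d + 1) κ + 1 := by linarith

/-- **THE SUP LETTER IN EVERY DIMENSION** (v1.1): `∃ C > 0` such that for every side, every `|B| ≤ R` and every `p`,
`|(H B)(p)| ≤ C·R` on `ℤ^{d+1}` — `‖H_M‖_{∞→∞} ≤ C(d,a)` uniformly in `M`, no dimension guard. [folklore] -/
theorem exists_abs_HBZd_le_all (d : ℕ) {a : ℝ} (ha : 0 < a) :
    ∃ C : ℝ, 0 < C ∧ ∀ (n : ℕ) (Bf : X (d + 1) → ℝ) (R : ℝ), (∀ y, |Bf y| ≤ R) →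
      ∀ p : X (d + 1), |HBZd n a Bf p| ≤ C * R := by
  obtain ⟨C, hC, h⟩ := exists_tsum_abs_kerH_le_all d ha
  refine ⟨C, hC, fun n Bf R hB p => ?_⟩
  have hR : 0 ≤ R := nonneg_of_abs_le hB
  have hsum : HasSum (fun y : X (d + 1) => R * |kerH n a p y|) (R * ∑' y : X (d + 1), |kerH n a p y|) :=
    (summable_abs_kerH_row n ha p).hasSum.mul_left R
  have h1 := tsum_of_norm_bounded hsum fun y => by
    rw [Real.norm_eq_abs, abs_mul]
    exact mul_le_mul_of_nonneg_right (hB y) (abs_nonneg _)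
  rw [Real.norm_eq_abs] at h1
  calc |HBZd n a Bf p| = |∑' y : X (d + 1), Bf y * kerH n a p y| := by rw [HBZd]
    _ ≤ R * ∑' y : X (d + 1), |kerH n a p y| := h1
    _ ≤ R * C := mul_le_mul_of_nonneg_left (h n p) hR
    _ = C * R := mul_comm _ _

/-- **THE RADIUS LETTER IN EVERY DIMENSION `≥ 3`** (v1.1): for `3 ≤ d + 1` there are `C > 0` and a side `M₀` such that for every side
`n + 1 ≥ M₀` HRS §3's letter `|√((n+1)²∕(n+1)^{d+1})|·C < 1` holds AND `C` bounds the section on `ℓ^∞` at that side — (46)'s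
`oneShot_radius_letter_supnorm` with the entry decay supplied by OSCST instead of `PoissonInterior`. [folklore] -/
theorem exists_oneShot_radius_letter_all (d : ℕ) (hd : 3 ≤ d + 1) {a : ℝ} (ha : 0 < a) :
    ∃ C : ℝ, 0 < C ∧ ∃ M₀ : ℕ, ∀ n : ℕ, M₀ ≤ n + 1 →
      |Real.sqrt ((((n : ℝ) + 1)) ^ 2 / (((n : ℝ) + 1)) ^ (d + 1))| * C < 1 ∧
      ∀ (Bf : X (d + 1) → ℝ) (R : ℝ), (∀ y, |Bf y| ≤ R) → ∀ p : X (d + 1), |HBZd n a Bf p| ≤ C * R := by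
  obtain ⟨C, hC, h⟩ := exists_abs_HBZd_le_all d ha
  obtain ⟨M₀, hM₀⟩ := radius_letter_eventually (d := d + 1) hC.le hd
  refine ⟨C, hC, M₀, fun n hn => ⟨?_, fun Bf R hB p => h n Bf R hB p⟩⟩
  have h1 := hM₀ (n + 1) hn
  push_cast at h1
  exact h1

end AllDimensions

end

end Summit.QuantumFields.BalabanUV.T4Continuum.NE7b.OneShotChartSupNorm
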